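import Literature.NumberTheory.EllipticCurves.BSDRankZeroDensity
import HarnessLib

/-!
# Bhargava–Skinner–Zhang 2014, Theorem 16 (with Bhargava–Shankar 2013, Theorem 6 / §5), as used in
# the proof of [BSZ] Cor. 26: inside any large family defined by congruence conditions at primes
# `p ≡ 1 (mod 4)` AND STABLE UNDER THE TWIST BY `-1` there is a finite union of large subfamilies of
# relative density `> 55.01 %`, stable under the twist by `-1`, on which `E` and `E₋₁` have opposite
# root numbers — cited-only named fact + the binder-shaped corollary (RE-TYPED 2026-08-24, see ERRATUM)

Topic `NumberTheory/EllipticCurves`, story `BhargavaSkinnerZhang2014/` (M. Bhargava, C. Skinner,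
W. Zhang, *A majority of elliptic curves over `ℚ` satisfy the Birch and Swinnerton-Dyer conjecture*,
arXiv:1407.1826 (2014); bib `BhargavaSkinnerZhang2014`), with its source M. Bhargava, A. Shankar, *The
average size of the `5`-Selmer group of elliptic curves is `6`, and the average rank is less than `1`*,
arXiv:1312.7859 (2013) (bib `BhargavaShankar5Selmer2013`; BSZ's reference [BS5]). PRIMARY READS
2026-08-23 on the held texts `paper:arxiv-1407.1826` (chunks `p0006`, `p0008`, `p0011`) and
`paper:arxiv-1312.7859` (chunks `p0004`, `p0017`–`p0019`); every locator below is chunk:line of the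
held text.

HONEST FRAMING (cell `b2b-bsdres`, BSD-DENSITY SPRINT task (b), book
`cells/density/CONVERSION-QUEUE.md` row **Q8** `hUflip` / `hU₀flip` (+ the relative-density binders
`hκU` / `hκU₀`), sprint table `pub/bsd-director/K1-AUDIT-TABLE.md` row **A2** `H:root`; D1-interim
service by the cell lead, lit GEN 117; RE-TYPED by lit GEN 118 on REFEREE 2's ruling R2-146.1, see the
ERRATUM section): the statement below is a SENTENCE typed from two arXiv PREPRINTS (neither has
appeared in a journal) in the reading [BSZ] give it where they use it, hypotheses complete; it is a
`def … : Prop` consumed BY NAME as a hypothesis — it proves nothing, books nothing and moves no density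
number, mark, label, count or tier; proposed sprint sub-label «literal-PRE» (the tier word is
referee A's). Net debt `+1` (D-0026), consumers named below. No `_holds` is expected from this file:
the printed proof is Bhargava–Shankar's §5 construction from the local root-number tables of
Halberstadt (`p = 2, 3`) and Rohrlich (`p > 3`) and the density computations of their §4 — none of
which the tree or Mathlib has as theorems (cf. the docstring of `rootNumber_negB_of_isBSFamily` in
`BSDRankZeroFamily.lean` on the tree's `WeierstrassCurve.localRootNumber`).

## ERRATUM (lit GEN 118, 2026-08-24; REFEREE 2 Gen 146, ruling R2-146.1, nit of record)

The first typing (lit GEN 117, p373543, decl `thm16_exists_rootNumber_twist_subfamily`) quantified over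
EVERY admissible family `F` (large; conditions only at primes `p ≡ 1 (mod 4)`; none at infinity) and
concluded the existence of a `negB`-STABLE finite union `F′ ⊆ F` of large subfamilies with sign-flipping
root numbers. That is STRONGER than print and FALSE: for an admissible `F` that is not itself stable
under `(A, B) ↦ (A, -B)` — REFEREE 2's example `F₀ = {E_{A,B} : B ≡ 1 (mod 5)}` (one condition, at the
prime `5 ≡ 1 (mod 4)`; large by the tree's own sieve) — no `negB`-stable sub-predicate of `F.Mem` of
positive density exists (`1 = -1` in `ZMod 5` is absurd), so the typed conclusion is unsatisfiable;
REFEREE 2 kernel-checked `¬ (statement)` on a byte-identical copy of the body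
(`HOME/b2b-bsdres-ref-2/g146/a328_large.lean`, axioms standard). The printed Theorem 16 asserts only
equidistribution of root numbers in `F′` and its relative density; the twist-stability and the
opposite-sign pairing are [BS5] Thm. 6's CONSTRUCTION property ("Specifically, we construct `F` so
that, for every `E ∈ F`, `E₋₁` is also in `F` …", built inside the family of ALL curves, §5 p0017
L111–L115: closure under `E ↦ E₋₁` enforced "by replacing `F₁` … by `F₁ ∪ {E : E₋₁ ∈ F₁}`"), and [BSZ]
use that reading ONLY inside families that are themselves stable under the `−1`-twist (proof of
Cor. 26, p0011 L84–L85: "since `S₁(5)` is stable under `−1`-twist, `F` also has the property that for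
all `E ∈ F` the root number of `E` and its `−1`-twist are both in `F` and have opposite signs";
`S₀(5) = {5 ∤ A}` and `S₁′(5)` are cut out by conditions invariant under `B ↦ -B`: `Δ(A, -B) = Δ(A, B)`
and the split/non-split criterion `u⁴ ≡ -3A` of Lemma 18, p0008 L79–L81, is `B`-free). The re-typed
fact below (NEW name `thm16_exists_rootNumber_twist_subfamily_of_twistStable`; the refuted decl is
REMOVED, it had no consumer outside this file) therefore carries the additional HYPOTHESIS
`(_hstab : ∀ AB, F.Mem AB → F.Mem (negB AB))` — REFEREE 2's fix (i) — and is the [BS5]-Thm-6 reading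
of [BSZ] Thm. 16 restricted to exactly the families for which [BSZ] assert it. The cell's consumers
are unaffected: `CellTheorem.TwistPaired` already carries `∀ AB, U AB → U (negB AB)`, and the sets the
sprint presents as `F` (`T = S₀(5) ∩ S₁′(5)`, `R = T₅`) are `negB`-stable by a one-line lemma each
(pub-bsdpct's C0). Registry: row A328 re-typed (decl renamed); K1 row A2's word was suspended to
«reading» by the sprint lead pending this revision (bsd-director, K1 v0.32).

## The printed statements (verbatim)

**[BSZ] Theorem 16** (`p0006` L65–L67): "Let `F` be any large family of elliptic curves over `ℚ`
defined by congruence conditions modulo powers of primes `p` such that `p ≡ 1 (mod 4)`. Then there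
exists a finite union `F′` of large subfamilies of `F` such that, when elliptic curves in `F` and `F′`
are ordered by height, the root numbers in `F′` are equidistributed and `F′` contains a density of
greater than `55.01%` of the elliptic curves in `F`." (L62–L63: "the following theorem which follows
from [BS5]".) **How [BSZ] read their Theorem 16 where it is used** (proof of Cor. 26, `p0011`
L80–L83): "By Theorem 16 there is a finite union `F′` of large subfamilies in `S₀(5) ∩ S₁′(5)` of
density `κμ(S₀(5) ∩ S₁′(5))` with `κ ≥ .5501` and such that for all `E ∈ F′` the root number of `E`
and its `−1`-twist have opposite signs. … since `S₁(5)` is stable under `−1`-twist, `F` also has the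
property that for all `E ∈ F` the root number of `E` and its `−1`-twist are both in `F` and have
opposite signs. In particular, the root numbers of the curves in `F` are equidistributed."
(§3.1, `p0008` L34–L38: "for both of the sets `F = S₀(5)` or `S₁′(5)`, we have
`μ_equi(F) = κ·μ(F)` with `κ ≥ .5501`; this will follow from Theorem 16 together with the fact …
that `S₀(5)` and `S₁′(5)` are large families defined by congruence conditions modulo powers of `5`.")
**[BS5] Theorem 6** (`p0004` L36–L44): "There exists a family `F` of elliptic curves `E_{A,B}`,
having density greater than `55.01%` among all elliptic curves when ordered height and defined by
congruence conditions on `A` and `B`, such that the root number of elliptic curves in `F` is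
equidistributed. Specifically, we construct `F` so that, for every elliptic curve `E ∈ F`, the
quadratic twist `E₋₁` of `E` is also in `F` and, moreover, `E` and `E₋₁` have opposite root
numbers." **[BS5] §5** (`p0017` L34–L39): "we construct a finite union of large families `F` of
elliptic curves such that every curve `E ∈ F` satisfies `E₋₁ ∈ F` and `d(E) = −1`" (`d(E) :=
r(E) r(E₋₁)`, L22–L27; `r(E)` the root number, L7–L8); construction = Props. 35 / 37, display (35)
`F = F⁺ ∪ F⁻` and "densities … at least `40.914%` and `58.534%`, respectively. This yields Theorem
(fam)" [= Thm. 6] (`p0019` L1–L6; `F⁺ ⊂ {Δ > 0}`, `F⁻ ⊂ {Δ < 0}`; our reading, as in the docstring of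
`BSDAverageRankFiveSelmer.lean`: `.2 × .40914 + .8 × .58534 = .5501`, the two sign classes carrying
different relative densities — which is why the family `F` of [BSZ] Thm. 16 may carry no condition at
infinity).
**Large family** ([BSZ] §2.3, `p0006` L17–L39): `Σ_ℓ ⊂ ℤ_ℓ²` closed with boundary of measure `0`,
`E_{A,B} ∈ F_Σ` iff `(A,B) ∈ Σ_ℓ` for all `ℓ`; "large if, for all sufficiently large primes `ℓ`, the
set `Σ_ℓ` contains all `E_{A,B}` with `(A,B) ∈ ℤ_ℓ²` such that `ℓ² ∤ Δ(A,B)`"; and L26–L30: "(Although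
we shall not do so in this article, we can also impose 'congruence conditions at infinity' …)" — so a
[BSZ] family carries NO sign condition on `Δ`.

## What is vendored, and in which currency (the verbatim ↔ Lean dictionary, one line per clause)

ONE cited-only named fact, `thm16_exists_rootNumber_twist_subfamily_of_twistStable`, in the
vocabulary of
`BSDRankZeroDensity.lean` (the tree's transcription of "families defined by congruence conditions":
`CongruenceFamily` = a modulus `p ^ expt p` and a residue set at every prime plus the two sign
permissions at infinity — the clopen special case of [BSZ]'s closed `Σ_ℓ`, a RESTRICTION of the
printed hypothesis class; `CongruenceFamily.IsLarge`; `UnionMem`; `negB (A, B) = (A, -B)` = the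
quadratic twist by `-1`, `E_{A,B} ↦ E_{A,-B}`; `WeierstrassCurve.rootNumber` of `shortWeierstrass`):
* "`F` any large family … defined by congruence conditions modulo powers of primes `p ≡ 1 (mod 4)`"
  = `F : CongruenceFamily`, `F.IsLarge`, no residue condition at the primes `p ≢ 1 (mod 4)`
  (`F.residues p = Set.univ`) and no condition at infinity (`F.allowPos`, `F.allowNeg` — [BSZ] §2.3);
  AND — the hypothesis under which [BSZ] use the [BS5] reading (proof of Cor. 26, p0011 L84–L85
  "since `S₁(5)` is stable under `−1`-twist") — `F` stable under the twist by `-1`: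
  `∀ AB, F.Mem AB → F.Mem (negB AB)` (ERRATUM above; without it the conclusion below is refutable).
* "a finite union `F′` of large subfamilies of `F`" = `G : Fin n → CongruenceFamily`, each `(G i)`
  large with `(G i).Mem ⊆ F.Mem`, `F′ = UnionMem G`.
* "for every `E ∈ F′`, `E₋₁ ∈ F′` and `E`, `E₋₁` have opposite root numbers" ([BS5] Thm. 6 /
  §5; [BSZ] proof of Cor. 26) = `UnionMem G AB → UnionMem G (negB AB)` and
  `(shortWeierstrass (negB AB)).rootNumber = -(shortWeierstrass AB).rootNumber` — LITERALLY the
  binders `hU` / `hUflip` (and `hU₀` / `hU₀flip`) of `bsz_rankLeOne_cRank_of_pieces`. (The printed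
  clause "the root numbers in `F′` are equidistributed" is the CONSEQUENCE [BS5] / [BSZ] draw from this
  pairing and the height invariance `H(E₋₁) = H(E)` — in the tree `card_filter_rootNumber_eq_one_eq`;
  it is not restated.)
* "`F′` contains a density of greater than `55.01%` of the elliptic curves in `F`" = the count form,
  for every `η > 0` eventually in `X`:
  `(0.5501 - η) · #{E ∈ F : H(E) < X} ≤ #{E ∈ F′ : H(E) < X}` — LITERALLY the binder `hκU` (resp.
  `hκU₀`) of `bsz_rankLeOne_cRank_of_pieces` with `T := F.Mem` (resp. `R`), `U := UnionMem G`, and the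
  abstract `BhargavaSkinnerZhang2014.RelDensityGE U F.Mem 0.5501` of `CellTheorem.lean`; it is IMPLIED
  by the printed clause (densities of large families exist and are positive, [BS2]; a ratio with limit
  `> .5501` is eventually `≥ .5501 − η`), i.e. this clause is typed WEAKER than print.
The twist-stability / sign-flip clauses are [BS5] Thm. 6's construction property AS [BSZ] USE IT, not
the printed sentence of Thm. 16; they are asserted here ONLY for `negB`-stable `F` (hypothesis `_hstab`),
the setting of [BSZ]'s use (ERRATUM). The two weakenings (clopen families; `liminf` count form) and this
one restriction of the hypothesis class are stated; the reading is the cell's «AS USED» reading of a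
preprint and is labelled so in the registry.

## Status paragraph (registry wording; the tier word is referee A's, the row is lit's pen)

Sources = two arXiv PREPRINTS: [BSZ] arXiv:1407.1826 (2014) Thm. 16, "which follows from [BS5]", and
[BS5] arXiv:1312.7859 (2013) Thm. 6 + §5 (Props. 35, 37; Halberstadt [Hal], Rohrlich [Rh]) — neither
published in a journal ⇒ proposed label «literal-PRE» (CONVERSION-QUEUE §0; pub-bsdpct `AUDIT.md`
§A2 "the 66.48 per cent theorem rests on two never-published preprints"). By-name consumers: the
binders `hU`, `hUflip`, `hκU` (with `T`) and `hU₀`, `hU₀flip`, `hκU₀` (with `R`) of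
`Literature.NumberTheory.EllipticCurves.bsz_rankLeOne_cRank_of_pieces`
(`LeadingTermBSZResCellAssemblyProofs.lean`; the res-cell assembly of record, `κ = .5501`) through
`thm16_exists_rootNumber_twist_subfamily_of_twistStable.exists_subfamily` below, once pub-bsdpct's C0
(`BSZPieces.lean`) presents `T = S₀(5) ∩ S₁′(5)` (conditions modulo powers of `5`, [BSZ] §3.2) and `R`
as `CongruenceFamily.Mem` together with their one-line `negB`-stability lemmas; and the abstract
`Cell.Holds.paired` / `.relDensity` (`TwistPaired`, `RelDensityGE`) of
`BhargavaSkinnerZhang2014/CellTheorem.lean`. Referee words of record: referee A R205.4 (a) and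
REFEREE 3 gen 155 read the four locators CONCORDANT AS PRINTED; REFEREE 2 Gen 146 R2-146.1 REFUTED the
first typing's extra generality (above) — this revision is its fix (i).

## Dedup (`lean search` + registry `CITED-FACTS.md`, 2026-08-23, this seat)

* `Literature.NumberTheory.EllipticCurves.exists_isLarge_rootNumber_twist_family`
  (`BSDRankZeroDensity.lean`) is the ABSOLUTE statement for the family of all curves with SOME positive
  density `c > 0`, cited to Bhargava–Shankar, Ann. of Math. 181 (2015) §4.1 (the `3`-Selmer paper's
  family; `55%` not claimed) — not Thm. 16's RELATIVE statement inside an arbitrary admissible `F` with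
  the constant `.5501`, which is what `hκU` / `hκU₀` consume (`U ⊆ T`, `U₀ ⊆ R`).
* `Literature.NumberTheory.EllipticCurves.rootNumber_negB_of_isBSFamily` (`BSDRankZeroFamily.lean`) is
  the flip on ONE explicit family (the ternary paper's `F`, conditions at `2`), not an existence
  statement inside a given `F`.
* `BSDAverageRankFiveSelmer.lean` takes [BS5] Thm. 6 as the anonymous binder `h6` (absolute form with
  pairwise disjoint pieces and `HeightDensityGE (UnionMem F) 0.5501`) and mints no fact (its docstring
  says so); this file does not restate `h6` (no disjointness is printed in Thm. 16) and is the first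
  `def` citing [BSZ] Thm. 16 (`lean search 'Thm 16' / 'TwistPaired' / 'RelDensityGE'`: only the
  abstract shapes of `CellTheorem.lean` over `Invariants`; registry §A: no row).

## References

* [BhargavaSkinnerZhang2014] M. Bhargava, C. Skinner, W. Zhang, arXiv:1407.1826 (2014): Thm. 16 and
  the sentence before it (§2.4, p. 6), §2.3 (large families), §3.1 (`μ_equi`, `κ ≥ .5501`), proof of
  Cor. 26 (§3.5).
* [BhargavaShankar5Selmer2013] M. Bhargava, A. Shankar, arXiv:1312.7859 (2013): Thm. 6 (§1), §5
  (Props. 35, 37, Lemma 36, display (35), proof of Thm. 6).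
-/

noncomputable section

open scoped Classical

open Filter WeierstrassCurve

namespace Literature.NumberTheory.EllipticCurves.BhargavaSkinnerZhang2014

/-- **Bhargava–Skinner–Zhang 2014, Theorem 16** (arXiv:1407.1826 §2.4, p. 6; held text
`paper:arxiv-1407.1826` p0006 L65–L67), verbatim: "Let `F` be any large family of elliptic curves over
`ℚ` defined by congruence conditions modulo powers of primes `p` such that `p ≡ 1 (mod 4)`. Then there
exists a finite union `F′` of large subfamilies of `F` such that, when elliptic curves in `F` and `F′`
are ordered by height, the root numbers in `F′` are equidistributed and `F′` contains a density of
greater than `55.01%` of the elliptic curves in `F`" — "which follows from [BS5]" (L62–L63), i.e. from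
**Bhargava–Shankar 2013, Theorem 6** (arXiv:1312.7859, p0004 L36–L44): "… Specifically, we construct
`F` so that, for every elliptic curve `E ∈ F`, the quadratic twist `E₋₁` of `E` is also in `F` and,
moreover, `E` and `E₋₁` have opposite root numbers" (§5, p0017 L34–L39: "every curve `E ∈ F` satisfies
`E₋₁ ∈ F` and `d(E) = r(E) r(E₋₁) = −1`"), and as [BSZ] use it (proof of Cor. 26, p0011 L80–L83):
"there is a finite union `F′` of large subfamilies in `S₀(5) ∩ S₁′(5)` of density
`κμ(S₀(5) ∩ S₁′(5))` with `κ ≥ .5501` and such that for all `E ∈ F′` the root number of `E` and its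
`−1`-twist have opposite signs".
Transcription (vocabulary of `BSDRankZeroDensity.lean`): `F : CongruenceFamily` large
(`CongruenceFamily.IsLarge`) with no residue condition at the primes `p ≢ 1 (mod 4)`
(`F.residues p = Set.univ`), no condition at infinity (`F.allowPos`, `F.allowNeg`; [BSZ] §2.3
imposes none) and — the setting in which [BSZ] use the [BS5] reading, p0011 L84–L85 "since `S₁(5)` is
stable under `−1`-twist" — `F` STABLE under `negB : (A, B) ↦ (A, -B)` (`_hstab`; ERRATUM in the module
docstring: without it the statement is refutable, REFEREE 2 R2-146.1); conclusion: finitely many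
large congruence subfamilies `G i` of `F` whose union
`F′ = UnionMem G` is stable under `negB : (A, B) ↦ (A, -B)` (the twist by `-1`, `E_{A,B} ↦ E_{A,-B}`),
on which `rootNumber (E_{A,-B}) = - rootNumber (E_{A,B})` (`WeierstrassCurve.rootNumber` of
`shortWeierstrass`), and which eventually contains at least `(0.5501 - η) · #{E ∈ F : H(E) < X}` of
the curves of naive height `< X`, for every `η > 0` (the count form of "density `> 55.01%` of the
curves in `F`"; weaker than print). The printed "root numbers in `F′` are equidistributed" is the
consequence of the pairing (`card_filter_rootNumber_eq_one_eq`) and is not restated.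
STATUS: both sources are arXiv PREPRINTS (2014 / 2013, no journal versions) and the twist clauses are
the «AS USED» reading ⇒ proposed label «literal-PRE» (the word is the sprint lead's / referee desks');
the printed proof ([BS5] §5: Halberstadt's and Rohrlich's local root numbers at
`2, 3` and `p > 3`, Props. 35 / 37) has no counterpart in the tree — nothing is asserted, no `_holds`
expected. By-name consumers: binders `hU` / `hUflip` / `hκU` (`U ⊆ T`) and `hU₀` / `hU₀flip` / `hκU₀`
(`U₀ ⊆ R`) of `bsz_rankLeOne_cRank_of_pieces` (via `exists_subfamily` below, with `T`, `R` presented as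
`CongruenceFamily.Mem` by pub-bsdpct's C0), and `TwistPaired` / `RelDensityGE` of `CellTheorem.lean`.
Dedup: `exists_isLarge_rootNumber_twist_family` (absolute, some `c > 0`, the ternary paper's family)
and `rootNumber_negB_of_isBSFamily` (one explicit family) are different statements; `h6` of
`BSDAverageRankFiveSelmer.lean` is an anonymous binder (absolute, disjoint pieces).
[cite: BhargavaSkinnerZhang2014, Thm. 16 (§2.4, p. 6; held text p0006 L65–L67) and proof of Cor. 26 (p0011 L80–L83)]
[cite: BhargavaShankar5Selmer2013, Thm. 6 (p0004 L36–L44) and §5 (p0017 L34–L39, Props. 35, 37)] -/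
def thm16_exists_rootNumber_twist_subfamily_of_twistStable : Prop :=
  ∀ (F : CongruenceFamily) (_hF : F.IsLarge)
    (_h4 : ∀ p : ℕ, p.Prime → p % 4 ≠ 1 → F.residues p = Set.univ)
    (_hpos : F.allowPos) (_hneg : F.allowNeg)
    (_hstab : ∀ AB, F.Mem AB → F.Mem (negB AB)),
    ∃ (n : ℕ) (G : Fin n → CongruenceFamily),
      (∀ i, (G i).IsLarge) ∧ (∀ i AB, (G i).Mem AB → F.Mem AB) ∧
      (∀ AB, UnionMem G AB → UnionMem G (negB AB)) ∧
      (∀ AB, UnionMem G AB →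
        (shortWeierstrass (negB AB)).rootNumber = -(shortWeierstrass AB).rootNumber) ∧
      ∀ η : ℝ, 0 < η → ∀ᶠ X : ℕ in atTop,
        (0.5501 - η) * ((heightFamilyBelow X).filter F.Mem).card ≤
          ((heightFamilyBelow X).filter (UnionMem G)).card

/-- **The binder shape.** Granted the fact, every admissible `F` (large; conditions only at primes
`p ≡ 1 (mod 4)`; no condition at infinity; stable under `(A, B) ↦ (A, -B)`) contains a sub-predicate
`U ⊆ F.Mem` that is stable under `(A, B) ↦ (A, -B)`, reverses the root number under it, and has
relative lower density `≥ .5501` in `F` in the count form — literally the binders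
`hUT`-`hU`-`hUflip`-`hκU` (with `T := F.Mem`) and
`hU₀R`-`hU₀`-`hU₀flip`-`hκU₀` (with `R`) of `bsz_rankLeOne_cRank_of_pieces`, and
`TwistPaired` ∧ `RelDensityGE U F.Mem 0.5501` of `CellTheorem.lean` (forgetting that `U` is a finite
union of large congruence families). [cite: BhargavaSkinnerZhang2014, Thm. 16 and proof of Cor. 26] -/
theorem thm16_exists_rootNumber_twist_subfamily_of_twistStable.exists_subfamily
    (h : thm16_exists_rootNumber_twist_subfamily_of_twistStable) (F : CongruenceFamily)
    (hF : F.IsLarge) (h4 : ∀ p : ℕ, p.Prime → p % 4 ≠ 1 → F.residues p = Set.univ)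
    (hpos : F.allowPos) (hneg : F.allowNeg) (hstab : ∀ AB, F.Mem AB → F.Mem (negB AB)) :
    ∃ U : ℤ × ℤ → Prop,
      (∀ AB, U AB → F.Mem AB) ∧ (∀ AB, U AB → U (negB AB)) ∧
      (∀ AB, U AB → (shortWeierstrass (negB AB)).rootNumber = -(shortWeierstrass AB).rootNumber) ∧
      ∀ η : ℝ, 0 < η → ∀ᶠ X : ℕ in atTop,
        (0.5501 - η) * ((heightFamilyBelow X).filter F.Mem).card ≤
          ((heightFamilyBelow X).filter U).card := by
  obtain ⟨n, G, -, hsub, hGstab, hflip, hdens⟩ := h F hF h4 hpos hneg hstab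
  exact ⟨UnionMem G, fun AB ⟨i, hi⟩ ↦ hsub i AB hi, hGstab, hflip, hdens⟩

/-! ### SHARPENING (lit GEN 121, 2026-08-24): the subfamilies AS CONSTRUCTED in [BS5] §5 are PAIRWISE DISJOINT

[BSZ] Thm. 16 prints "a finite union `F′` of large subfamilies of `F`"; the cell's capstone needs the
`5`-Selmer average on `F′` (binder `h13U₀` of `bsz_rankLeOne_cRank_of_pieces`, fed from [BS5] Thm. 31 =
the named fact `thm31_heightAverageOn_card_selmerFive_le_six` through its
`sum_card_selmerFive_le_of_disjoint`), which is available for a finite union of large families only when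
the union is DISJOINT (cell book `cells/density/C0-SPEC.md`, gap G2). The construction [BSZ] point to
("which follows from [BS5]", p0006 L62–L63; "By construction", p0007 L2–L3) gives exactly that. [BS5]
§5 (held text `paper:arxiv-1312.7859`): the family of Thm. 6 is `F⁺ ∪ F⁻`,
`F⁺ = ((F₁ ∩ F₄) ∪ (F₂ ∩ F₃)) ∩ {Δ > 0}`, `F⁻ = ((F₁ ∩ F₃) ∪ (F₂ ∩ F₄)) ∩ {Δ < 0}` (p0018 L117–L121),
where "the sets `F₁` and `F₂` are disjoint and defined via congruence conditions modulo powers of `2`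
and `3`, while the sets `F₃` and `F₄` are disjoint and defined via congruence conditions modulo powers
of primes greater than `3`. All four of these sets are finite unions of large families" (p0018
L110–L115); `F₁`, `F₂` are unions over `(i, j, k, ℓ)` of the intersections `G₂(i,j) ∩ G₃(k,ℓ)` of the
rows of Tables 2 and 3 — "These families are disjoint" (p0017 L75–L79), "defined by finitely many
congruence conditions modulo powers of `p`" (p0017 L98–L99), (5.1) p0017 L105–L110; `F₃` / `F₄` are cut
out by the conditions `α_p(E) = ±1` (p0018 L40–L56: reduction type and `v_p(Δ) ∈ {1,3}` / `{2,4}` resp.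
`= 2` / `= 3` — congruence conditions modulo `p⁵`) at the primes `p ≡ 3 (mod 4)`, the exceptional
primes (where `α_p = -1`) being at most two and "smaller than `10000`" (p0018 L58–L68); the closures
under `E ↦ E₋₁` (p0017 L112–L115, p0018 L104–L107) and the intersection with the given `F` ([BSZ]) add
conditions invariant under, resp. independent of, these. Hence ALL the subfamilies so obtained impose
THE SAME conditions outside the finite set of primes `S = {2, 3} ∪ {p ≡ 3 (mod 4), p < 10⁴}` (and at
infinity one of the two signs), and differ only by residue conditions modulo bounded powers of the
primes in `S`: refining by the finitely many atoms of the Boolean algebra these residue conditions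
generate writes `F′` as a finite union of PAIRWISE DISJOINT congruence families, each large (a condition
at finitely many primes does not affect largeness: `CongruenceFamily.IsLarge` quantifies over all
sufficiently large primes; at every prime `p ∉ S`, `p > 3`, the first `α_p`-condition contains every
curve with `p² ∤ Δ`). The fact below adds exactly this clause — `(G i).Mem ∩ (G j).Mem = ∅` for
`i ≠ j` — to `thm16_exists_rootNumber_twist_subfamily_of_twistStable`, which it implies (`.to_thm16`);
same hypotheses (in particular the twist-stability `_hstab` of the ERRATUM), same weakenings, same
status (two arXiv PREPRINTS; the disjointness is the cell's «AS CONSTRUCTED» reading of [BS5] §5, not a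
printed sentence of [BSZ] Thm. 16) ⇒ proposed sub-label «literal-PRE / as-constructed»; net debt `+1`
(D-0026), by-name consumer: the binder `h13U₀` (with `hU₀` / `hU₀flip` / `hκU₀` from the SAME `G`) of
`bsz_rankLeOne_cRank_of_pieces`, glue in `BhargavaSkinnerZhang2014/PiecesResiduePresentationProofs.lean`.
No `_holds` is expected (as for the un-sharpened fact). -/

/-- **[BSZ] Theorem 16 in the [BS5]-§5 reading, with the subfamilies AS CONSTRUCTED — a finite union
of PAIRWISE DISJOINT large congruence subfamilies** of a large, twist-stable family `F` with
conditions only at primes `p ≡ 1 (mod 4)`: stable under the twist by `-1`, with `E`, `E₋₁` of opposite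
root numbers on it, and of relative lower density `≥ .5501` in `F` (count form). See the SHARPENING
note above for the disjointness (atoms of the finitely many residue conditions at
`S = {2, 3} ∪ {p ≡ 3 (4), p < 10⁴}` by which the constructed pieces differ) and the ERRATUM for `_hstab`.
[cite: BhargavaSkinnerZhang2014, Thm. 16 (§2.4, p0006 L65–L67; "follows from [BS5]" L62–L63; "By construction" p0007 L2–L3) and proof of Cor. 26 (p0011 L80–L85)]
[cite: BhargavaShankar5Selmer2013, Thm. 6 (p0004 L36–L44) and §5 (p0017 L75–L79, L98–L99, L105–L115; Prop. 37 and p0018 L40–L68, L104–L121; p0019 L1–L6)] -/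
def thm16_exists_disjoint_rootNumber_twist_subfamily_of_twistStable : Prop :=
  ∀ (F : CongruenceFamily) (_hF : F.IsLarge)
    (_h4 : ∀ p : ℕ, p.Prime → p % 4 ≠ 1 → F.residues p = Set.univ)
    (_hpos : F.allowPos) (_hneg : F.allowNeg)
    (_hstab : ∀ AB, F.Mem AB → F.Mem (negB AB)),
    ∃ (n : ℕ) (G : Fin n → CongruenceFamily),
      (∀ i, (G i).IsLarge) ∧ (∀ i AB, (G i).Mem AB → F.Mem AB) ∧
      (∀ i j, i ≠ j → ∀ AB, (G i).Mem AB → ¬ (G j).Mem AB) ∧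
      (∀ AB, UnionMem G AB → UnionMem G (negB AB)) ∧
      (∀ AB, UnionMem G AB →
        (shortWeierstrass (negB AB)).rootNumber = -(shortWeierstrass AB).rootNumber) ∧
      ∀ η : ℝ, 0 < η → ∀ᶠ X : ℕ in atTop,
        (0.5501 - η) * ((heightFamilyBelow X).filter F.Mem).card ≤
          ((heightFamilyBelow X).filter (UnionMem G)).card

/-- The sharpened fact implies the fact of record (forget the disjointness).
[cite: BhargavaSkinnerZhang2014, Thm. 16] -/
theorem thm16_exists_disjoint_rootNumber_twist_subfamily_of_twistStable.to_thm16
    (h : thm16_exists_disjoint_rootNumber_twist_subfamily_of_twistStable) :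
    thm16_exists_rootNumber_twist_subfamily_of_twistStable := by
  intro F hF h4 hpos hneg hstab
  obtain ⟨n, G, hL, hsub, -, hst, hflip, hdens⟩ := h F hF h4 hpos hneg hstab
  exact ⟨n, G, hL, hsub, hst, hflip, hdens⟩

/-- **The binder shape with the pieces exposed.** Granted the sharpened fact, every admissible,
twist-stable `F` contains pairwise disjoint large congruence subfamilies `G i` whose union `U` is
twist-stable, reverses the root number, and has relative lower density `≥ .5501` in `F` (count form) —
`hU₀R`-`hU₀`-`hU₀flip`-`hκU₀` of `bsz_rankLeOne_cRank_of_pieces` — AND is presented as the disjoint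
union the `5`-Selmer-average fact wants for `h13U₀` (`sum_card_selmerFive_le_of_disjoint`).
[cite: BhargavaSkinnerZhang2014, Thm. 16 and proof of Cor. 26] -/
theorem thm16_exists_disjoint_rootNumber_twist_subfamily_of_twistStable.exists_disjoint_subfamily
    (h : thm16_exists_disjoint_rootNumber_twist_subfamily_of_twistStable) (F : CongruenceFamily)
    (hF : F.IsLarge) (h4 : ∀ p : ℕ, p.Prime → p % 4 ≠ 1 → F.residues p = Set.univ)
    (hpos : F.allowPos) (hneg : F.allowNeg) (hstab : ∀ AB, F.Mem AB → F.Mem (negB AB)) :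
    ∃ (n : ℕ) (G : Fin n → CongruenceFamily) (U : ℤ × ℤ → Prop),
      (∀ i, (G i).IsLarge) ∧ (∀ i j, i ≠ j → ∀ AB, (G i).Mem AB → ¬ (G j).Mem AB) ∧
      (∀ AB, U AB ↔ ∃ i, (G i).Mem AB) ∧
      (∀ AB, U AB → F.Mem AB) ∧ (∀ AB, U AB → U (negB AB)) ∧
      (∀ AB, U AB → (shortWeierstrass (negB AB)).rootNumber = -(shortWeierstrass AB).rootNumber) ∧
      ∀ η : ℝ, 0 < η → ∀ᶠ X : ℕ in atTop,
        (0.5501 - η) * ((heightFamilyBelow X).filter F.Mem).card ≤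
          ((heightFamilyBelow X).filter U).card := by
  obtain ⟨n, G, hL, hsub, hdisj, hGstab, hflip, hdens⟩ := h F hF h4 hpos hneg hstab
  exact ⟨n, G, UnionMem G, hL, hdisj, fun _ ↦ Iff.rfl, fun AB ⟨i, hi⟩ ↦ hsub i AB hi, hGstab, hflip,
    hdens⟩

end Literature.NumberTheory.EllipticCurves.BhargavaSkinnerZhang2014

end
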